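import Summits.ResolutionOfSingularities.ResolutionOfSingularities.Theorems.PurityTransfer.Negative.ResidueCartier

/-!
# `PurityTransfer` (crux stmt-ResolutionOfSingularities-17142) — negative side, file 4/5:
# the RESIDUE HOMOMORPHISM on the crux's symbolic `H³₂(𝔽₂(x,y))` and the valuation ring `O`

* `katoRel_le_ker` — the residue `Φ₁` (`Φ[a,b,c} =` the `x⁻¹y⁻¹`-coefficient of `a · dlog b ∧ dlog c`
  in the expansion at infinity) kills all seven of Kato's relation families of the crux's `let N`
  (R1–R4 (bi)linearity, R5–R6 exactness, R7 Artin–Schreier = the Cartier identity), so it descends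
  to `G ⧸ N` as `QuotientAddGroup.lift (katoRel 2 K) Φ₁ katoRel_le_ker`;
* `sym_one_x_y_ne_zero` — **`[1, x, y} ≠ 0` in `G ⧸ N`**: the crux's typed symbolic group is not
  degenerate (a missing/surplus relation was the crux's own named risk);
* `O` (the monomial valuation ring at infinity, residue field `𝔽₂`, value group `ℤ ×ₗ ℤ`) contains
  `𝔽₂` (`algebraMap_mem_O`), misses `x` (`xK_notMem_O`), has NO nonzero polynomial in its maximal
  ideal (`algebraMap_notMem_nonunits`: the centre of `O` on `𝔽₂[x,y]` is `0`), and the residue kills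
  `Unr O` by a support estimate (`coeff_ℓ₀_mul_G_eq_zero`, `unr_O_le_ker`); hence
  **`[1,x,y} ∉ Unr O`** and **`Unr O ≠ ⊤`** (`unr_O_ne_top`): the crux's conclusion has content.
Nothing here refutes the crux. [cite: Kato1982, §1]
-/

noncomputable section

-- single-problem summit: the doubled namespace component `ResolutionOfSingularities` is forced
set_option linter.dupNamespace false

open Finset

namespace Summit.ResolutionOfSingularities.ResolutionOfSingularities.Theorems.PurityTransfer.Negative

section FunctionField

open MvPolynomial

/-- exponents of monomials are `≤ 0` (expansion at infinity). -/
theorem expo_le_zero (s : Fin 2 →₀ ℕ) : expo s ≤ 0 := by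
  change toLex (-(s 1 : ℤ), -(s 0 : ℤ)) ≤ toLex ((0 : ℤ), (0 : ℤ))
  rw [Prod.Lex.toLex_le_toLex]
  simp only
  omega

/-- the coefficients of `ιP P` off the monomial exponents vanish. -/
theorem coeff_ιP_of_forall_ne (P : Poly) (g : Γ₂) (hg : ∀ s, expo s ≠ g) : (ιP P).coeff g = 0 := by
  classical
  conv_lhs => rw [P.as_sum]
  rw [map_sum, HahnSeries.coeff_sum]
  refine Finset.sum_eq_zero fun s _ => ?_
  rw [ιP_monomial, HahnSeries.coeff_single_of_ne (fun h => hg s h.symm)]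

/-- support of the image of a polynomial lies in the non-positive cone. -/
theorem orderTop_ιP_le_zero {P : Poly} (hP : P ≠ 0) : (ιP P).orderTop ≤ 0 := by
  obtain ⟨s, hs⟩ : ∃ s, coeff s P ≠ 0 := by
    by_contra! h
    exact hP (MvPolynomial.ext _ _ (by simpa using h))
  have h1 : (ιP P).orderTop ≤ expo s :=
    HahnSeries.orderTop_le_of_coeff_ne_zero (by rwa [coeff_ιP_expo])
  exact h1.trans (by exact_mod_cast expo_le_zero s)

/-- `ιK` of a unit is nonzero. -/
theorem ιK_unit_ne_zero (u : Kˣ) : ιK (u : K) ≠ 0 := (map_ne_zero ιK).mpr u.ne_zero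

/-! ### the residue kills Kato's relations -/

/-- the residue of a single symbol `[a, b, c}`. -/
theorem Φ₁_of (a : K) (b c : Kˣ) :
    Φ₁ (FreeAbelianGroup.of (a, b, c)) = (ιK a * G (ιK (b : K)) (ιK (c : K))).coeff ℓ₀ := by
  rw [Φ₁, FreeAbelianGroup.lift_apply_of]; rfl

/-- **the residue kills all seven of Kato's relation families.** -/
theorem katoRel_le_ker : katoRel 2 K ≤ Φ₁.ker := by
  rw [katoRel, AddSubgroup.closure_le]
  rintro x (⟨a, a', b, c, rfl⟩ | ⟨a, b, b', c, rfl⟩ | ⟨a, b, c, c', rfl⟩ | ⟨a, b, rfl⟩ |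
    ⟨b, c, rfl⟩ | ⟨b, c, rfl⟩ | ⟨a, b, c, rfl⟩) <;>
    simp only [SetLike.mem_coe, AddMonoidHom.mem_ker, map_sub, Φ₁_of]
  · -- R1 additivity in `a`
    rw [map_add, add_mul, HahnSeries.coeff_add]; ring
  · -- R2 multiplicativity in `b`
    rw [Units.val_mul, map_mul, G_mul_left (ιK_unit_ne_zero b) (ιK_unit_ne_zero b'), mul_add,
      HahnSeries.coeff_add]; ring
  · -- R3 multiplicativity in `c`
    rw [Units.val_mul, map_mul, G_mul_right (ιK_unit_ne_zero c) (ιK_unit_ne_zero c'), mul_add,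
      HahnSeries.coeff_add]; ring
  · -- R4 `[a, b, b} = 0`
    rw [G_self, mul_zero, HahnSeries.coeff_zero]
  · -- R5 `[b, b, c} = 0` (exactness of `db ∧ dlog c`)
    exact coeff_self_mul_G (ιK_unit_ne_zero b) (ιK_unit_ne_zero c)
  · -- R6 `[c, b, c} = 0`
    rw [G_swap, mul_neg, HahnSeries.coeff_neg, coeff_self_mul_G (ιK_unit_ne_zero c) (ιK_unit_ne_zero b),
      neg_zero]
  · -- R7 `[a² - a, b, c} = 0` (the Cartier identity)
    rw [map_pow, sq, sub_mul, HahnSeries.coeff_sub,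
      coeff_sq_mul_G (ιK a) (ιK_unit_ne_zero b) (ιK_unit_ne_zero c), sub_self]

/-- the residue of `[1, x, y}` is `1`. -/
theorem Φ₁_sym_one_x_y : Φ₁ (FreeAbelianGroup.of ((1 : K), xU, yU)) = 1 := by
  rw [Φ₁_of, map_one, one_mul]
  change (G (ιK xK) (ιK yK)).coeff ℓ₀ = 1
  rw [ιK_xK, ιK_yK, coeff_G_XH_YH]

/-- **`H³₂(𝔽₂(x,y))` in the crux's symbolic presentation is nontrivial**: `[1, x, y} ≠ 0` in
`G ⧸ N` (its residue is `1`). -/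
theorem sym_one_x_y_ne_zero :
    ((FreeAbelianGroup.of ((1 : K), xU, yU) : FreeAbelianGroup (K × Kˣ × Kˣ)) :
      FreeAbelianGroup (K × Kˣ × Kˣ) ⧸ katoRel 2 K) ≠ 0 := by
  intro h
  have hmem := (QuotientAddGroup.eq_zero_iff _).mp h
  have h0 : Φ₁ (FreeAbelianGroup.of ((1 : K), xU, yU)) = 0 := katoRel_le_ker hmem
  rw [Φ₁_sym_one_x_y] at h0
  exact one_ne_zero h0

/-! ### the valuation ring `O` -/

/-- membership in `O`: non-negative leading exponent of the expansion at infinity. -/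
theorem mem_O_iff (a : K) : a ∈ O ↔ 0 ≤ (ιK a).orderTop := Iff.rfl

/-- the constants `𝔽₂ ⊆ O`. -/
theorem algebraMap_mem_O (c : ZMod 2) : algebraMap (ZMod 2) K c ∈ O := by
  fin_cases c
  · show algebraMap (ZMod 2) K 0 ∈ O
    rw [map_zero]; exact O.zero_mem
  · show algebraMap (ZMod 2) K 1 ∈ O
    rw [map_one]; exact O.one_mem

/-- `x ∉ O`: the affine model `𝔽₂[x,y]` is NOT contained in `O`. -/
theorem not_zero_le_gx : ¬ ((0 : Γ₂) ≤ gx) := by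
  change ¬ (toLex ((0 : ℤ), (0 : ℤ)) ≤ toLex ((0 : ℤ), (-1 : ℤ)))
  rw [Prod.Lex.toLex_le_toLex]
  simp

/-- `x ∉ O` (its exponent `gx` is negative). -/
theorem xK_notMem_O : xK ∉ O := by
  rw [mem_O_iff, ιK_xK, XH, HahnSeries.orderTop_single one_ne_zero]
  intro h
  exact not_zero_le_gx (by exact_mod_cast h)

/-- nonzero polynomials are never in the maximal ideal of `O` (their leading exponent is `≤ 0`):
the centre of `O` on `𝔽₂[x,y]` is the zero ideal. -/
theorem algebraMap_notMem_nonunits {P : Poly} (hP : P ≠ 0) : algebraMap Poly K P ∉ O.nonunits := by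
  rw [ValuationSubring.mem_nonunits_iff]
  intro hlt
  -- v(P) < 1 means P⁻¹ ∉ O
  have hP' : algebraMap Poly K P ≠ 0 :=
    (map_ne_zero_iff _ (IsFractionRing.injective Poly K)).mpr hP
  have hnot : (algebraMap Poly K P)⁻¹ ∉ O := by
    intro hmem
    have := (O.valuation_le_one_iff _).mpr hmem
    rw [map_inv₀, inv_le_one₀ (by
      rw [Valuation.pos_iff]; exact hP')] at this
    exact not_lt.mpr this hlt
  apply hnot
  rw [mem_O_iff, map_inv₀, orderTop_inv ((map_ne_zero ιK).mpr hP'), ιK_algebraMap]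
  have h0 := orderTop_ιP_le_zero hP
  have hne : ιP P ≠ 0 := fun h => hP (ιP_injective (by rw [h, map_zero]))
  rw [← HahnSeries.order_eq_orderTop_of_ne_zero hne] at h0
  have : (ιP P).order ≤ 0 := by exact_mod_cast h0
  exact_mod_cast (neg_nonneg.mpr this)

/-! ### the residue kills the `O`-integral symbols -/

/-- for a series of order `0`, the twisted derivation with shift `e` has leading exponent `> e` (the constant term is killed by `θ 0 = 0`). -/
theorem lt_orderTop_D {e : Γ₂} {θ : Γ₂ →+ ZMod 2} {β : H} (hβ0 : β ≠ 0) (hβ : β.order = 0) :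
    (e : WithTop Γ₂) < (D e θ β).orderTop := by
  have hcoeff : ∀ g ≤ e, (D e θ β).coeff g = 0 := by
    intro g hg
    rw [coeff_D]
    rcases lt_or_eq_of_le hg with hlt | rfl
    · rw [HahnSeries.coeff_eq_zero_of_lt_orderTop, mul_zero]
      rw [← HahnSeries.order_eq_orderTop_of_ne_zero hβ0, hβ]
      exact_mod_cast (sub_neg.mpr hlt)
    · rw [sub_self, map_zero, zero_mul]
  refine lt_of_le_of_ne ?_ ?_
  · rw [HahnSeries.le_orderTop_iff_forall]
    intro j hj
    exact hcoeff j (le_of_lt (by exact_mod_cast hj))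
  · exact (HahnSeries.orderTop_ne_of_coeff_eq_zero (hcoeff e le_rfl)).symm

/-- strict additivity of lower bounds in `WithTop Γ₂` when the bounds are finite. -/
theorem add_lt_add_of_coe_lt {u v : Γ₂} {a b : WithTop Γ₂} (ha : (u : WithTop Γ₂) < a)
    (hb : (v : WithTop Γ₂) < b) : ((u + v : Γ₂) : WithTop Γ₂) < a + b := by
  induction a using WithTop.recTopCoe with
  | top => rw [top_add]; exact WithTop.coe_lt_top _
  | coe a =>
    induction b using WithTop.recTopCoe with
    | top => rw [add_top]; exact WithTop.coe_lt_top _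
    | coe b =>
      rw [← WithTop.coe_add, WithTop.coe_lt_coe]
      exact add_lt_add (WithTop.coe_lt_coe.mp ha) (WithTop.coe_lt_coe.mp hb)

/-- **support estimate**: for `α` integral and `β, γ` units of the valuation (order `0`), the
series `α · G(β,γ)` has leading exponent `> ℓ₀`, so its residue vanishes. -/
theorem coeff_ℓ₀_mul_G_eq_zero {α β γ : H} (hα : 0 ≤ α.orderTop) (hβ0 : β ≠ 0) (hβ : β.order = 0)
    (hγ0 : γ ≠ 0) (hγ : γ.order = 0) : (α * G β γ).coeff ℓ₀ = 0 := by
  apply HahnSeries.coeff_eq_zero_of_lt_orderTop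
  rw [G_eq]
  have hJ : (ℓ₀ : WithTop Γ₂) < (J β γ).orderTop := by
    unfold J
    have h1 : (ℓ₀ : WithTop Γ₂) < (D ex θx β * D ey θy γ).orderTop :=
      lt_of_lt_of_le (add_lt_add_of_coe_lt (lt_orderTop_D hβ0 hβ) (lt_orderTop_D hγ0 hγ))
        HahnSeries.orderTop_add_le_mul
    have h2 : (ℓ₀ : WithTop Γ₂) < (D ey θy β * D ex θx γ).orderTop := by
      refine lt_of_lt_of_le ?_ HahnSeries.orderTop_add_le_mul
      have := add_lt_add_of_coe_lt (lt_orderTop_D (e := ey) (θ := θy) hβ0 hβ)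
        (lt_orderTop_D (e := ex) (θ := θx) hγ0 hγ)
      rwa [show ey + ex = ℓ₀ from rfl] at this
    rw [sub_eq_add_neg]
    refine lt_of_lt_of_le ?_ HahnSeries.min_orderTop_le_orderTop_add
    rw [HahnSeries.orderTop_neg]
    exact lt_min h1 h2
  have hinv : ∀ {u : H}, u ≠ 0 → u.order = 0 → (0 : WithTop Γ₂) ≤ u⁻¹.orderTop := by
    intro u hu0 hu
    rw [orderTop_inv hu0, hu, neg_zero, WithTop.coe_zero]
  have hprod : (ℓ₀ : WithTop Γ₂) < (J β γ * (β⁻¹ * γ⁻¹)).orderTop := by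
    refine lt_of_lt_of_le ?_ HahnSeries.orderTop_add_le_mul
    refine lt_of_lt_of_le hJ (le_add_of_nonneg_right ?_)
    exact le_trans (add_nonneg (hinv hβ0 hβ) (hinv hγ0 hγ)) HahnSeries.orderTop_add_le_mul
  refine lt_of_lt_of_le ?_ HahnSeries.orderTop_add_le_mul
  exact lt_of_lt_of_le hprod (le_add_of_nonneg_left hα)

/-- a unit of `O` has leading exponent `0`. -/
theorem order_eq_zero_of_mem_O {b : K} (hb : b ≠ 0) (h1 : b ∈ O) (h2 : b⁻¹ ∈ O) :
    (ιK b).order = 0 := by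
  have hu : ιK b ≠ 0 := (map_ne_zero ιK).mpr hb
  rw [mem_O_iff] at h1 h2
  rw [map_inv₀, orderTop_inv hu] at h2
  rw [← HahnSeries.order_eq_orderTop_of_ne_zero hu] at h1
  have h1' : 0 ≤ (ιK b).order := by exact_mod_cast h1
  have h2' : 0 ≤ -(ιK b).order := by exact_mod_cast h2
  exact le_antisymm (neg_nonneg.mp h2') h1'

/-- **the residue kills `Unr(O)`**: every `O`-integral class has residue `0` (the residue
homomorphism on `G ⧸ N` is `QuotientAddGroup.lift (katoRel 2 K) Φ₁ katoRel_le_ker`). -/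
theorem unr_O_le_ker :
    unr 2 K O.toSubring ≤ (QuotientAddGroup.lift (katoRel 2 K) Φ₁ katoRel_le_ker).ker := by
  rw [unr, AddSubgroup.closure_le]
  rintro y ⟨a, b, c, ha, hb, hbi, hc, hci, rfl⟩
  rw [SetLike.mem_coe, AddMonoidHom.mem_ker, QuotientAddGroup.lift_mk, Φ₁_of]
  rw [ValuationSubring.mem_toSubring] at ha hb hbi hc hci
  rw [Units.val_inv_eq_inv_val] at hbi hci
  exact coeff_ℓ₀_mul_G_eq_zero ha (ιK_unit_ne_zero b) (order_eq_zero_of_mem_O b.ne_zero hb hbi)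
    (ιK_unit_ne_zero c) (order_eq_zero_of_mem_O c.ne_zero hc hci)

/-- **`[1, x, y}` is not `O`-integral** (it has residue `1`, while `Unr O` has residue `0`). -/
theorem sym_one_x_y_notMem_unr_O :
    ((FreeAbelianGroup.of ((1 : K), xU, yU) : FreeAbelianGroup (K × Kˣ × Kˣ)) :
      FreeAbelianGroup (K × Kˣ × Kˣ) ⧸ katoRel 2 K) ∉ unr 2 K O.toSubring := by
  intro h
  have := unr_O_le_ker h
  rw [AddMonoidHom.mem_ker, QuotientAddGroup.lift_mk, Φ₁_sym_one_x_y] at this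
  exact one_ne_zero this

/-- `Unr(O) ≠ ⊤`: the conclusion of the crux has content at this `O`. -/
theorem unr_O_ne_top : unr 2 K O.toSubring ≠ ⊤ := fun h =>
  sym_one_x_y_notMem_unr_O (h ▸ AddSubgroup.mem_top _)

end FunctionField

end Summit.ResolutionOfSingularities.ResolutionOfSingularities.Theorems.PurityTransfer.Negative
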